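/-
Copyright: b2b-lace packet (carver, gen 53).  [FvdH17] §4.2 (4.17) with an EXACT middle line, `𝓣_{m₁,1̲,m₃}(v,y,x)`:
the exact bond pins ONE edge position of the coded trail, so the (5.40)-type extraction of [NoBLE17] §5.3.2 applies with
line indices `(m₁, 1 + m₃)`, junction `v`, LINEAR multiplicity `L + 1 − m₁ − (1 + m₃)` and the two remainder slots of the
repulsive bubble — node EXL-XSLOT (interior exact leg) of the cell's N76 map.  Proofs only; no named fact; no numeral; no
dimension.
-/
import Literature.Probability.FitznerVanDerHofstad2017.RepulsiveTriangleExtractionIndep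
import Literature.Probability.FitznerVanDerHofstad2017.NobleBubbleLetterSums
import Literature.Probability.FitznerVanDerHofstad2017.NobleElementsClosedFormsPerc
import HarnessLib

/-!
# [FvdH17] (4.17) with an exact middle bond: the trail-level extraction at linear multiplicity

For the instance `Letters.perc d p` of the NoBLE letters, the repulsive triangle letter with an exact-one-bond middle
line, `𝓣_{m₁,1̲,m₃}(v,y,x) = max_c ℙ_p^{⊗3}({0 ←m₁→ v}_{c₀} ⊛ {v –1̲– y}_{c₁} ⊛ {y ←m₃→ x}_{c₂})`, is bounded by the
right-hand side of [NoBLE17] (5.40) at line indices `(m₁, 1 + m₃)` with the junction read at `v`: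

* **Coding** (`exists_trail_of_mem_genDisjOcc_lineEvents₃_eqOne₂`): the witness of the exact line is the single bond
  `(v,y)`; restricting the three levels to the witness sets and applying the landed triangle coding
  `exists_trail_of_mem_genDisjConnN_triLines` yields ONE bond-self-avoiding word `W` of length `L` with `W(r) = v`,
  `W(r+1) = y`, `W(L) = x`, the arcs `[0,r)`, `[r,r+1)`, `[r+1,L)` open on the levels `c₀, c₁, c₂` — the middle arc has
  exactly one edge because a trail has `#arc = length` (`IsTrail.card_wordArc`).
* **Extraction** (`mem_boxes_of_trail_eqOne₂`): cut at `M` exactly as in (5.40) with `m₂ := 1 + m₃` — explicit (`L < M`),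
  one-tail (`r < M − (1+m₃)`), two-tail (`r ≥ M − (1+m₃)`); the boxes are the landed labelled boxes `piecesE W r (r+1)`,
  `piecesO u r (r+1) x`, `piecesT3 u₁ [e] u₃ x v y` (middle word of length `1`), so the landed membership and measure
  lemmas (`mem_box*_of_trail`, `piReal_box*_le`: independence across levels × BK within) are used verbatim; the index of a
  box is the (5.40) index (`idxExplicitB ⊔ idxOneTailB ⊔ idxTwoTail` at `(m₁, 1+m₃)`), the position of `y` being determined by it.
* **Summation** (`piReal_genDisjOcc_lineEvents₃_eqOne₂_le`, `sum_perc_T_ge_eqOne_ge_toReal_le_extraction`,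
  `sum_sum_perc_T_ge_eqOne_ge_toReal_le_slots`, `tsum_tsum_perc_T_ge_eqOne_ge_le_ofReal`, cells `perc_matA_zero_one_le_xslot`,
  `perc_vecPE_one_le_xslot`, `perc_matA_one_one_le_xslot`): the sum over `y` is fiberwise over the determined position, then the landed
  `sum_le_extraction_of_pointwise` and `sum_le_repBubble_slots` give
  `Σ_{v∈S₁} Σ_{y∈S₂} 𝓣_{m₁,1̲,m₃}(v,y,x) ≤ Σ_{L∈[m₁+1+m₃, M)} (L−m₁−m₃)·a_L(x)·p^L + (M−m₁−1−m₃)·p^M Γ̄₂ R₁ + p^M Γ̄₂² R₂`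
  (`R₁` valid for `[M]`, `R₂` for `[M−(1+m₃), 1+m₃]` on the endpoint set), i.e. `bubbleSlotR p Γ̄₂ m₁ (1+m₃) M N R₁ R₂`.

## References
* [FvdH17] R. Fitzner, R. van der Hofstad, Mean-field behavior for nearest-neighbor percolation in `d > 10`,
  Electron. J. Probab. 22 (2017) no. 43; arXiv:1506.07977v2 — §4.2 Def. 4.1, (4.16)–(4.18) and the display after (4.18)
  (v2 pp. 34–36 = EJP p. 33); App. B Tables B.2/B.4 rows (1,1) (pp. 73–74).
* [NoBLE17] R. Fitzner, R. van der Hofstad, Generalized approach to the non-backtracking lace expansion,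
  Probab. Theory Relat. Fields 169 (2017) 1041–1119 — §5.3.1 (5.35)–(5.38) p. 1097, §5.3.2 (5.40)–(5.41) p. 1098.
-/

noncomputable section

namespace Literature.Probability.FitznerVanDerHofstad2017.NobleBlocks

open _root_.MeasureTheory Finset
open scoped BigOperators ENNReal
open Literature.Probability.LatticeModels Literature.Probability.Percolation
open Literature.Barriers.CriticalPhenomena
open Literature.Probability.FitznerVanDerHofstad2017
open Literature.Probability.FitznerVanDerHofstad2017.NobleBlocks.LenIdx

variable {d : ℕ}

/-! ## A. Coding: the exact middle bond is one edge of the trail -/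

/-- **Coding of a member of `𝓣_{m₁,1̲,m₃}(v,y,x)`.**  If `ω ∈ {0 ←m₁→ v}_{c₀} ⊛ {v –1̲– y}_{c₁} ⊛ {y ←m₃→ x}_{c₂}`
(lattice configurations), there is ONE bond-self-avoiding word `W` of length `L` with `W(r) = v`, `W(r+1) = y`,
`W(L) = x` (`m₁ ≤ r`, `r + 1 + m₃ ≤ L`), the arc `[0,r)` open in `ω_{c₀}`, the bond `[r,r+1)` in `ω_{c₁}`, the arc
`[r+1,L)` in `ω_{c₂}`: the landed triangle coding applied to the witness sets, the middle witness shrunk to the bond.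
[cite: FitznerVanDerHofstad2017, §4.2 Def. 4.1, (4.17) (arXiv:1506.07977v2 pp. 35–36 = EJP p. 33)]
[cite: FitznerVanDerHofstad2016NoBLE, §5.3.1 (5.35) PTRF p. 1097] -/
theorem exists_trail_of_mem_genDisjOcc_lineEvents₃_eqOne₂ {k : ℕ} {c : Fin 3 → Fin k}
    {ω : Fin k → BondConfig (Site d)} (hω : ∀ j, ω j ⊆ (zdGraph d).edgeSet) {m₁ m₃ : ℕ} {v y x : Site d}
    (h : ω ∈ genDisjOcc (lineEvents₃ (ge m₁) (eq 1) (ge m₃) v y x) c) :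
    ∃ (L r : ℕ) (W : Fin L → Fin d × Bool), IsTrail W ∧ m₁ ≤ r ∧ r + 1 + m₃ ≤ L ∧
      wordPos W r = v ∧ wordPos W (r + 1) = y ∧ wordPos W L = x ∧
      (↑(wordArc W 0 r) : Set (Sym2 (Site d))) ⊆ ω (c 0) ∧
        (↑(wordArc W r (r + 1)) : Set (Sym2 (Site d))) ⊆ ω (c 1) ∧
          (↑(wordArc W (r + 1) L) : Set (Sym2 (Site d))) ⊆ ω (c 2) := by
  classical
  obtain ⟨K, hKω, hKA, hdisj⟩ := h
  have hA0 : K 0 ∈ (openConnGe m₁ (0 : Site d) v : Set (BondConfig (Site d))) := by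
    simpa [lineEvents₃] using hKA 0
  have hA1 : K 1 ∈ (openConnEq 1 v y : Set (BondConfig (Site d))) := by simpa [lineEvents₃] using hKA 1
  have hA2 : K 2 ∈ (openConnGe m₃ y x : Set (BondConfig (Site d))) := by simpa [lineEvents₃] using hKA 2
  obtain ⟨hvy, hb⟩ := (mem_openConnEq_one_iff v y (K 1)).1 hA1
  have hb0 : s(v, y) ∉ K 0 := fun h' => Set.disjoint_left.1 (hdisj (show (0 : Fin 3) ≠ 1 by decide)) h' hb
  have hb2 : s(v, y) ∉ K 2 := fun h' => Set.disjoint_left.1 (hdisj (show (2 : Fin 3) ≠ 1 by decide)) h' hb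
  -- the witness configurations on three levels, the middle one shrunk to the bond
  let ω' : Fin 3 → BondConfig (Site d) := ![K 0, {s(v, y)}, K 2]
  have hω'0 : ω' 0 = K 0 := rfl
  have hω'1 : ω' 1 = {s(v, y)} := rfl
  have hω'2 : ω' 2 = K 2 := rfl
  have hω'lat : ∀ j, ω' j ⊆ (zdGraph d).edgeSet := by
    intro j
    fin_cases j
    · exact (hKω 0).trans (hω _)
    · show ({s(v, y)} : Set (Sym2 (Site d))) ⊆ _
      exact Set.singleton_subset_iff.2 (hω _ (hKω 1 hb))
    · exact (hKω 2).trans (hω _)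
  have hmem : ω' ∈ genDisjConnN (triLines (fun i : Fin 3 => i) m₁ 1 m₃ v y x) := by
    refine ⟨fun i => ω' i, fun i => ?_, fun i => ?_, ?_⟩
    · fin_cases i <;> simp [triLines]
    · fin_cases i
      · simpa [triLines, GDLine.event, hω'0] using hA0
      · simpa [triLines, GDLine.event, hω'1] using
          openConnEq_subset_openConnGe 1 v y
            ((mem_openConnEq_one_iff v y ({s(v, y)} : Set (Sym2 (Site d)))).2 ⟨hvy, Set.mem_singleton _⟩)
      · simpa [triLines, GDLine.event, hω'2] using hA2
    · intro i j hij
      fin_cases i <;> fin_cases j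
      · exact absurd rfl hij
      · simpa [hω'0, hω'1] using hb0
      · simpa [hω'0, hω'2] using hdisj (show (0 : Fin 3) ≠ 2 by decide)
      · simpa [hω'0, hω'1] using hb0
      · exact absurd rfl hij
      · simpa [hω'1, hω'2] using hb2
      · simpa [hω'0, hω'2] using hdisj (show (2 : Fin 3) ≠ 0 by decide)
      · simpa [hω'1, hω'2] using hb2
      · exact absurd rfl hij
  obtain ⟨L, r₁, r₂, W, hW, hr₁, hr₁₂, hr₂L, hv, hy, hx, h0, h1, h2⟩ :=
    exists_trail_of_mem_genDisjConnN_triLines hω'lat hmem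
  -- the middle arc is the single bond: a trail has `r₂ − r₁` distinct edges there, all equal to `(v,y)`
  have hcard : (wordArc W r₁ r₂).card ≤ 1 := by
    have hsub : wordArc W r₁ r₂ ⊆ {s(v, y)} := by
      intro e he
      have := h1 (Finset.mem_coe.2 he)
      simpa [hω'1] using this
    simpa using Finset.card_le_card hsub
  rw [hW.card_wordArc (by omega)] at hcard
  have hr₂ : r₂ = r₁ + 1 := by omega
  subst hr₂
  refine ⟨L, r₁, W, hW, hr₁, by omega, hv, hy, hx, ?_, ?_, ?_⟩
  · exact h0.trans (by rw [hω'0]; exact hKω 0)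
  · refine h1.trans ?_
    rw [hω'1]
    exact Set.singleton_subset_iff.2 (hKω 1 hb)
  · exact h2.trans (by rw [hω'2]; exact hKω 2)

/-! ## B. Extraction: an open labelled trail with its pinned bond lies in one of the (5.40) boxes -/

section Extraction

variable {k : ℕ} (c : Fin 3 → Fin k)

/-- The first bond of a segment is the one-bond segment (word coding of trails).
[cite: FitznerVanDerHofstad2016NoBLE, §5.3.1 (5.35)–(5.36) (PTRF 169 (2017) p. 1097)] -/
theorem wordTake_wordSeg_one {L : ℕ} (W : Fin L → Fin d × Bool) {r m₃ : ℕ} (h : r + (1 + m₃) ≤ L)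
    (h₁ : r + 1 ≤ L) :
    wordTake (wordSeg W r (1 + m₃) h) 1 (by omega) = wordSeg W r 1 h₁ := by
  funext i
  rfl

/-- The other bonds of a segment are the segment read one step later (word coding of trails).
[cite: FitznerVanDerHofstad2016NoBLE, §5.3.1 (5.35)–(5.36) (PTRF 169 (2017) p. 1097)] -/
theorem wordSeg_wordSeg_one {L : ℕ} (W : Fin L → Fin d × Bool) {r m₃ : ℕ} (h : r + (1 + m₃) ≤ L)
    (h₂ : r + 1 + m₃ ≤ L) :
    wordSeg (wordSeg W r (1 + m₃) h) 1 m₃ (by omega) = wordSeg W (r + 1) m₃ h₂ := by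
  funext i
  simp only [wordSeg]
  congr 1
  exact Fin.ext (by simp only; omega)

/-- **Extraction with a pinned bond** (the three cases of (5.40) at `m₂ := 1 + m₃`, junction `v`, the position of `y`
determined): an open labelled trail lies in the labelled box of an EXPLICIT index (`L < M`: arcs `[0,r)`, `[r,r+1)`,
`[r+1,L)`), of a ONE-TAIL index (`r < M − (1+m₃)`: the arcs of `W|[0,M)` and the tail `{W(M) ↔ x}`), or of a TWO-TAIL
index (`r ≥ M − (1+m₃)`: `W|[0,M−(1+m₃))` and its tail to `v` on line 1, the bond on line 2, the next `m₃` bonds and the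
tail to `x` on line 3 — the landed `piecesT3` with a middle word of length `1`).
[cite: FitznerVanDerHofstad2016NoBLE, §5.3.1 (5.38) p. 1097, §5.3.2 (5.40)–(5.41) p. 1098]
[cite: FitznerVanDerHofstad2017, §4.2, display after (4.18) (arXiv:1506.07977v2 p. 36 = EJP p. 33)] -/
theorem mem_boxes_of_trail_eqOne₂ (m₁ m₃ M : ℕ) {ω : Fin k → BondConfig (Site d)} {L r : ℕ} {v y x : Site d}
    {W : Fin L → Fin d × Bool} (hW : IsTrail W) (hr : m₁ ≤ r) (hrL : r + 1 + m₃ ≤ L)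
    (hv : wordPos W r = v) (hy : wordPos W (r + 1) = y) (hx : wordPos W L = x)
    (h0 : (↑(wordArc W 0 r) : Set (Sym2 (Site d))) ⊆ ω (c 0))
    (h1 : (↑(wordArc W r (r + 1)) : Set (Sym2 (Site d))) ⊆ ω (c 1))
    (h2 : (↑(wordArc W (r + 1) L) : Set (Sym2 (Site d))) ⊆ ω (c 2)) :
    (∃ LW ∈ idxExplicitB m₁ (1 + m₃) M x v,
        wordPos LW.2.1 (LW.2.2 + 1) = y ∧ ω ∈ boxOf (piecesE LW.2.1 LW.2.2 (LW.2.2 + 1)) labE c) ∨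
      (∃ ur ∈ idxOneTailB (d := d) m₁ (1 + m₃) M v,
          wordPos ur.1 (ur.2 + 1) = y ∧ ω ∈ boxOf (piecesO ur.1 ur.2 (ur.2 + 1) x) labO c) ∨
        ∃ uu ∈ idxTwoTail (d := d) (1 + m₃) M,
          v + wordPos uu.2 1 = y ∧
            ω ∈ boxOf (piecesT3 (M := M) (m₂ := 1) (m₃ := m₃) uu.1 (wordTake uu.2 1 (by omega))
              (wordSeg uu.2 1 m₃ (by omega)) x v (v + wordPos uu.2 1)) labT3 c := by
  classical
  by_cases hLM : L < M
  · refine Or.inl ⟨⟨L, (W, r)⟩, ?_, hy, ?_⟩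
    · simp only [idxExplicitB, Finset.mem_sigma, Finset.mem_filter, Finset.mem_product, mem_trailWordsTo,
        Finset.mem_Ico, Finset.mem_Icc]
      exact ⟨⟨by omega, hLM⟩, ⟨⟨hW, hx⟩, hr, by omega⟩, hv⟩
    · show ω ∈ boxOf (piecesE W r (r + 1)) labE c
      exact mem_boxE_of_trail c hW (Nat.le_succ r) (by omega) h0 h1 h2
  · replace hLM : M ≤ L := not_lt.1 hLM
    by_cases hrM : r < M - (1 + m₃)
    · refine Or.inr (Or.inl ⟨(wordTake W M hLM, r), ?_, ?_,
        mem_boxO_of_trail c hW hLM (by omega) (by omega) hx h0 h1 h2⟩)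
      · rw [idxOneTailB, Finset.mem_filter, Finset.mem_product, mem_trailWords, Finset.mem_Ico]
        exact ⟨⟨hW.wordTake hLM, hr, hrM⟩, by rw [wordPos_wordTake W hLM (by omega), hv]⟩
      · show wordPos (wordTake W M hLM) (r + 1) = y
        rw [wordPos_wordTake W hLM (by omega), hy]
    · replace hrM : M - (1 + m₃) ≤ r := not_lt.1 hrM
      have hML : M - (1 + m₃) ≤ L := by omega
      have hrL' : r + (1 + m₃) ≤ L := by omega
      have hr1L : r + 1 ≤ L := by omega
      have hyv : v + wordPos (wordSeg W r (1 + m₃) hrL') 1 = y := by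
        rw [← hv, wordPos_wordSeg W hrL' (by omega), hy]
      refine Or.inr (Or.inr ⟨(wordTake W (M - (1 + m₃)) hML, wordSeg W r (1 + m₃) hrL'), ?_, hyv, ?_⟩)
      · rw [idxTwoTail, Finset.mem_product, mem_trailWords, mem_trailWords]
        exact ⟨hW.wordTake hML, hW.wordSeg hrL'⟩
      · show ω ∈ boxOf (piecesT3 (M := M) (m₂ := 1) (m₃ := m₃) (wordTake W (M - (1 + m₃)) hML)
          (wordTake (wordSeg W r (1 + m₃) hrL') 1 (by omega)) (wordSeg (wordSeg W r (1 + m₃) hrL') 1 m₃ (by omega))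
          x v (v + wordPos (wordSeg W r (1 + m₃) hrL') 1)) labT3 c
        rw [wordTake_wordSeg_one W hrL' hr1L, wordSeg_wordSeg_one W hrL' hrL, hyv]
        exact mem_boxT3_of_trail c hW hrM le_rfl hrL hML hr1L hv hy hx h0 h1 h2

end Extraction

/-! ## C. The pointwise bound of a member and the sum over the determined position -/

section Pointwise

variable {k : ℕ}

/-- **(4.17) with an exact middle bond, member `c`, pointwise in `(v,y)`, by extraction**:
`ℙ_p^{⊗k}({0 ←m₁→ v}_{c₀} ⊛ {v –1̲– y}_{c₁} ⊛ {y ←m₃→ x}_{c₂})` is at most the sum of the (5.40) values (junction `v`,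
line indices `(m₁, 1+m₃)`) over the indices whose determined position is `y`: configurations off the lattice are null;
on the lattice the coded trail lies in a box (`mem_boxes_of_trail_eqOne₂`) whose measure is the value
(`piReal_boxE_le`, `piReal_boxO_le`, `piReal_boxT3_le` with the middle tail `τ_p(y,y) = 1`).
[cite: FitznerVanDerHofstad2016NoBLE, §5.3.2 (5.40)–(5.41) PTRF p. 1098]
[cite: FitznerVanDerHofstad2017, §4.2 (4.17) and the display after (4.18) (arXiv:1506.07977v2 p. 36 = EJP p. 33)] -/
theorem piReal_genDisjOcc_lineEvents₃_eqOne₂_le (c : Fin 3 → Fin k) (p : unitInterval) (m₁ m₃ M : ℕ)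
    (x v y : Site d) :
    (Measure.pi (fun _ : Fin k => bondPercolation (zdGraph d) p)).real
        (genDisjOcc (lineEvents₃ (ge m₁) (eq 1) (ge m₃) v y x) c) ≤
      (∑ LW ∈ (idxExplicitB m₁ (1 + m₃) M x v).filter (fun LW => wordPos LW.2.1 (LW.2.2 + 1) = y),
          (p : ℝ) ^ LW.1) +
        (∑ ur ∈ (idxOneTailB (d := d) m₁ (1 + m₃) M v).filter (fun ur => wordPos ur.1 (ur.2 + 1) = y),
            (p : ℝ) ^ M * tau d p (wordPos ur.1 M) x) +
          ∑ uu ∈ (idxTwoTail (d := d) (1 + m₃) M).filter (fun uu => v + wordPos uu.2 1 = y),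
            (p : ℝ) ^ (M - (1 + m₃)) * (p : ℝ) ^ (1 + m₃) *
              (tau d p (wordPos uu.1 (M - (1 + m₃))) v * tau d p (v + wordPos uu.2 (1 + m₃)) x) := by
  classical
  set μ := bondPercolation (zdGraph d) p with hμ
  set ν : Measure (Fin k → BondConfig (Site d)) := Measure.pi (fun _ : Fin k => μ) with hν
  set T : Set (Fin k → BondConfig (Site d)) := genDisjOcc (lineEvents₃ (ge m₁) (eq 1) (ge m₃) v y x) c with hT
  set IE := (idxExplicitB m₁ (1 + m₃) M x v).filter (fun LW => wordPos LW.2.1 (LW.2.2 + 1) = y) with hIE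
  set IO := (idxOneTailB (d := d) m₁ (1 + m₃) M v).filter (fun ur => wordPos ur.1 (ur.2 + 1) = y) with hIO
  set IT := (idxTwoTail (d := d) (1 + m₃) M).filter (fun uu => v + wordPos uu.2 1 = y) with hIT
  set UE : Set (Fin k → BondConfig (Site d)) :=
    ⋃ LW ∈ IE, boxOf (piecesE LW.2.1 LW.2.2 (LW.2.2 + 1)) labE c with hUE
  set UO : Set (Fin k → BondConfig (Site d)) := ⋃ ur ∈ IO, boxOf (piecesO ur.1 ur.2 (ur.2 + 1) x) labO c with hUO
  set UT : Set (Fin k → BondConfig (Site d)) :=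
    ⋃ uu ∈ IT, boxOf (piecesT3 (M := M) (m₂ := 1) (m₃ := m₃) uu.1 (wordTake uu.2 1 (by omega))
      (wordSeg uu.2 1 m₃ (by omega)) x v (v + wordPos uu.2 1)) labT3 c with hUT
  set bad : Set (Fin k → BondConfig (Site d)) :=
    ⋃ j : Fin k, Function.eval j ⁻¹' {ω | ¬ ω ⊆ (zdGraph d).edgeSet} with hbad
  have h0 : μ {ω | ¬ ω ⊆ (zdGraph d).edgeSet} = 0 := by
    have := ProbabilityTheory.setBernoulli_ae_subset (u := (zdGraph d).edgeSet) (p := p)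
    rw [Filter.Eventually, mem_ae_iff, Set.compl_setOf] at this
    exact this
  have hbad0 : ν.real bad = 0 := by
    rw [measureReal_def, measure_iUnion_null fun j => ?_, ENNReal.toReal_zero]
    exact Measure.pi_eval_preimage_null (fun _ : Fin k => μ) h0
  -- the covering
  have hcov : T ⊆ bad ∪ (UE ∪ UO ∪ UT) := by
    intro ω hω
    by_cases hb : ∀ j, ω j ⊆ (zdGraph d).edgeSet
    · right
      obtain ⟨L, r, W, hW, hr, hrL, hv, hy, hx, hW0, hW1, hW2⟩ :=
        exists_trail_of_mem_genDisjOcc_lineEvents₃_eqOne₂ hb hω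
      rcases mem_boxes_of_trail_eqOne₂ c m₁ m₃ M hW hr hrL hv hy hx hW0 hW1 hW2 with
        ⟨LW, hLW, hLWy, hωE⟩ | ⟨ur, hur, hury, hωO⟩ | ⟨uu, huu, huuy, hωT⟩
      · exact Or.inl (Or.inl (Set.mem_iUnion₂.2 ⟨LW, Finset.mem_filter.2 ⟨hLW, hLWy⟩, hωE⟩))
      · exact Or.inl (Or.inr (Set.mem_iUnion₂.2 ⟨ur, Finset.mem_filter.2 ⟨hur, hury⟩, hωO⟩))
      · exact Or.inr (Set.mem_iUnion₂.2 ⟨uu, Finset.mem_filter.2 ⟨huu, huuy⟩, hωT⟩)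
    · left
      obtain ⟨j, hj⟩ := not_forall.1 hb
      exact Set.mem_iUnion.2 ⟨j, hj⟩
  -- the measure of each box
  have hE : ν.real UE ≤ ∑ LW ∈ IE, (p : ℝ) ^ LW.1 := by
    refine (measureReal_biUnion_finset_le _ _).trans (Finset.sum_le_sum fun LW hLW => ?_)
    have hi := (Finset.mem_filter.1 hLW).1
    simp only [idxExplicitB, Finset.mem_sigma, Finset.mem_filter, Finset.mem_product, mem_trailWordsTo,
      Finset.mem_Ico, Finset.mem_Icc] at hi
    exact piReal_boxE_le c p hi.2.1.1.1 (by omega) (by omega)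
  have hO : ν.real UO ≤ ∑ ur ∈ IO, (p : ℝ) ^ M * tau d p (wordPos ur.1 M) x := by
    refine (measureReal_biUnion_finset_le _ _).trans (Finset.sum_le_sum fun ur hur => ?_)
    have hi := (Finset.mem_filter.1 hur).1
    simp only [idxOneTailB, Finset.mem_filter, Finset.mem_product, mem_trailWords, Finset.mem_Ico] at hi
    exact piReal_boxO_le c p hi.1.1 (by omega) (by omega) x
  have hT3 : ν.real UT ≤ ∑ uu ∈ IT, (p : ℝ) ^ (M - (1 + m₃)) * (p : ℝ) ^ (1 + m₃) *
      (tau d p (wordPos uu.1 (M - (1 + m₃))) v * tau d p (v + wordPos uu.2 (1 + m₃)) x) := by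
    refine (measureReal_biUnion_finset_le _ _).trans (Finset.sum_le_sum fun uu huu => ?_)
    have hi := (Finset.mem_filter.1 huu).1
    simp only [idxTwoTail, Finset.mem_product, mem_trailWords] at hi
    have h := piReal_boxT3_le (M := M) (m₂ := 1) (m₃ := m₃) c p hi.1 (hi.2.wordTake (M := 1) (by omega))
      (hi.2.wordSeg (a := 1) (m := m₃) le_rfl) x v (v + wordPos uu.2 1)
    have hmid : v + wordPos (wordTake uu.2 1 (by omega : 1 ≤ 1 + m₃)) 1 = v + wordPos uu.2 1 := by
      rw [wordPos_wordTake uu.2 _ le_rfl]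
    have hend : v + wordPos uu.2 1 + wordPos (wordSeg uu.2 1 m₃ (by omega : 1 + m₃ ≤ 1 + m₃)) m₃ =
        v + wordPos uu.2 (1 + m₃) := by
      rw [add_assoc, wordPos_wordSeg uu.2 _ le_rfl]
    rw [hmid, tau_self, mul_one, hend] at h
    calc _ ≤ _ := h
      _ = _ := by rw [pow_add, pow_one]; ring
  calc ν.real T ≤ ν.real (bad ∪ (UE ∪ UO ∪ UT)) := measureReal_mono hcov
    _ ≤ ν.real bad + ν.real (UE ∪ UO ∪ UT) := measureReal_union_le _ _
    _ ≤ 0 + (ν.real UE + ν.real UO + ν.real UT) := by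
        refine add_le_add hbad0.le ((measureReal_union_le _ _).trans ?_)
        exact add_le_add (measureReal_union_le _ _) le_rfl
    _ ≤ _ := by rw [zero_add]; exact add_le_add (add_le_add hE hO) hT3

/-- `ℙ_p^{⊗3}` of the instance's letters is the product Bernoulli measure of `piReal_genDisjOcc_lineEvents₃_eqOne₂_le`,
in `ℝ≥0∞`. [cite: FitznerVanDerHofstad2017, §4.2 (4.17) (arXiv:1506.07977v2 p. 36)] -/
theorem piPerc_genDisjOcc_lineEvents₃_ge_eqOne_ge_eq_ofReal (p : unitInterval) (c : Fin 3 → Fin 3) (m₁ m₃ : ℕ)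
    (v y x : Site d) :
    piPerc d p 3 (genDisjOcc (lineEvents₃ (ge m₁) (eq 1) (ge m₃) v y x) c) =
      ENNReal.ofReal ((Measure.pi (fun _ : Fin 3 => bondPercolation (zdGraph d) p)).real
        (genDisjOcc (lineEvents₃ (ge m₁) (eq 1) (ge m₃) v y x) c)) := by
  rw [piPerc, ofReal_measureReal (measure_ne_top _ _)]

end Pointwise

/-! ## D. The letter `𝓣_{m₁,1̲,m₃}` of the instance: maximum over the assignments, slots, `∑'` -/

section Letter

variable (p : unitInterval)

/-- **`𝓣_{m₁,1̲,m₃}(v,y,x)` pointwise by extraction** (every member of the maximum obeys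
`piReal_genDisjOcc_lineEvents₃_eqOne₂_le`, whose right-hand side does not depend on the assignment).
[cite: FitznerVanDerHofstad2017, §4.2 (4.17) (arXiv:1506.07977v2 p. 36 = EJP p. 33)]
[cite: FitznerVanDerHofstad2016NoBLE, §5.3.2 (5.40)–(5.41) PTRF p. 1098] -/
theorem perc_T_ge_eqOne_ge_toReal_le_sum_filter (m₁ m₃ M : ℕ) (x v y : Site d) :
    ((Letters.perc d p).T (ge m₁) (eq 1) (ge m₃) v y x).toReal ≤
      (∑ LW ∈ (idxExplicitB m₁ (1 + m₃) M x v).filter (fun LW => wordPos LW.2.1 (LW.2.2 + 1) = y),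
          (p : ℝ) ^ LW.1) +
        (∑ ur ∈ (idxOneTailB (d := d) m₁ (1 + m₃) M v).filter (fun ur => wordPos ur.1 (ur.2 + 1) = y),
            (p : ℝ) ^ M * tau d p (wordPos ur.1 M) x) +
          ∑ uu ∈ (idxTwoTail (d := d) (1 + m₃) M).filter (fun uu => v + wordPos uu.2 1 = y),
            (p : ℝ) ^ (M - (1 + m₃)) * (p : ℝ) ^ (1 + m₃) *
              (tau d p (wordPos uu.1 (M - (1 + m₃))) v * tau d p (v + wordPos uu.2 (1 + m₃)) x) := by
  classical
  have hp0 : 0 ≤ (p : ℝ) := p.2.1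
  set B := (∑ LW ∈ (idxExplicitB m₁ (1 + m₃) M x v).filter (fun LW => wordPos LW.2.1 (LW.2.2 + 1) = y),
          (p : ℝ) ^ LW.1) +
        (∑ ur ∈ (idxOneTailB (d := d) m₁ (1 + m₃) M v).filter (fun ur => wordPos ur.1 (ur.2 + 1) = y),
            (p : ℝ) ^ M * tau d p (wordPos ur.1 M) x) +
          ∑ uu ∈ (idxTwoTail (d := d) (1 + m₃) M).filter (fun uu => v + wordPos uu.2 1 = y),
            (p : ℝ) ^ (M - (1 + m₃)) * (p : ℝ) ^ (1 + m₃) *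
              (tau d p (wordPos uu.1 (M - (1 + m₃))) v * tau d p (v + wordPos uu.2 (1 + m₃)) x) with hB
  have hB0 : 0 ≤ B :=
    add_nonneg (add_nonneg (Finset.sum_nonneg fun _ _ => pow_nonneg hp0 _)
      (Finset.sum_nonneg fun _ _ => mul_nonneg (pow_nonneg hp0 _) (tau_nonneg _ _ _)))
      (Finset.sum_nonneg fun _ _ => mul_nonneg (mul_nonneg (pow_nonneg hp0 _) (pow_nonneg hp0 _))
        (mul_nonneg (tau_nonneg _ _ _) (tau_nonneg _ _ _)))
  have hle : (Letters.perc d p).T (ge m₁) (eq 1) (ge m₃) v y x ≤ ENNReal.ofReal B := by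
    rw [perc_T, repLetter]
    refine Finset.sup_le fun c _ => ?_
    rw [piPerc_genDisjOcc_lineEvents₃_ge_eqOne_ge_eq_ofReal]
    exact ENNReal.ofReal_le_ofReal (piReal_genDisjOcc_lineEvents₃_eqOne₂_le c p m₁ m₃ M x v y)
  have := ENNReal.toReal_mono ENNReal.ofReal_ne_top hle
  rwa [ENNReal.toReal_ofReal hB0] at this

/-- **[NoBLE17] (5.40) shape for `Σ_{y∈S₂} 𝓣_{m₁,1̲,m₃}(v,y,x)`** (line indices `(m₁, 1+m₃)`, junction `v`): the
pointwise hypothesis of `sum_le_extraction_of_pointwise`.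
[cite: FitznerVanDerHofstad2016NoBLE, §5.3.2 (5.40) PTRF p. 1098]
[cite: FitznerVanDerHofstad2017, §4.2 (4.17), display after (4.18) (arXiv:1506.07977v2 p. 36 = EJP p. 33)] -/
theorem sum_perc_T_ge_eqOne_ge_toReal_le_extraction (m₁ m₃ M : ℕ) (x v : Site d) (S₂ : Finset (Site d)) :
    ∑ y ∈ S₂, ((Letters.perc d p).T (ge m₁) (eq 1) (ge m₃) v y x).toReal ≤
      (∑ LW ∈ idxExplicitB m₁ (1 + m₃) M x v, (p : ℝ) ^ LW.1) +
        (∑ ur ∈ idxOneTailB (d := d) m₁ (1 + m₃) M v, (p : ℝ) ^ M * tau d p (wordPos ur.1 M) x) +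
          ∑ uu ∈ idxTwoTail (d := d) (1 + m₃) M,
            (p : ℝ) ^ (M - (1 + m₃)) * (p : ℝ) ^ (1 + m₃) *
              (tau d p (wordPos uu.1 (M - (1 + m₃))) v * tau d p (v + wordPos uu.2 (1 + m₃)) x) := by
  classical
  have hp0 : 0 ≤ (p : ℝ) := p.2.1
  refine (Finset.sum_le_sum fun y _ => perc_T_ge_eqOne_ge_toReal_le_sum_filter p m₁ m₃ M x v y).trans ?_
  rw [Finset.sum_add_distrib, Finset.sum_add_distrib]
  refine add_le_add (add_le_add ?_ ?_) ?_
  · exact Finset.sum_fiberwise_le_sum_of_sum_fiber_nonneg fun y _ =>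
      Finset.sum_nonneg fun _ _ => pow_nonneg hp0 _
  · exact Finset.sum_fiberwise_le_sum_of_sum_fiber_nonneg fun y _ =>
      Finset.sum_nonneg fun _ _ => mul_nonneg (pow_nonneg hp0 _) (tau_nonneg _ _ _)
  · exact Finset.sum_fiberwise_le_sum_of_sum_fiber_nonneg fun y _ =>
      Finset.sum_nonneg fun _ _ => mul_nonneg (mul_nonneg (pow_nonneg hp0 _) (pow_nonneg hp0 _))
        (mul_nonneg (tau_nonneg _ _ _) (tau_nonneg _ _ _))

/-- **EXL-XSLOT (interior exact leg) at remainder slots, all finite `S₁, S₂`** (`d ≥ 2`, `p < p_c`, `1 + m₃ ≤ M`,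
`x ∈ X`; `R₁` valid for `[M]`, `R₂` for `[M−(1+m₃), 1+m₃]` on `X`):
`Σ_{v∈S₁} Σ_{y∈S₂} 𝓣_{m₁,1̲,m₃}(v,y,x) ≤ Σ_{L=m₁+1+m₃}^{M−1} (L+1−m₁−(1+m₃)) a_L(x) p^L + (M−m₁−(1+m₃)) p^M Γ̄₂ R₁ + p^M Γ̄₂² R₂`
— the repulsive BUBBLE bound (5.40) at `(m₁, 1+m₃)`: the exact bond costs one unit of length and no multiplicity.
[cite: FitznerVanDerHofstad2016NoBLE, §5.3.2 (5.40) p. 1098, first display p. 1097]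
[cite: FitznerVanDerHofstad2017, §4.2 (4.17), (4.18) and the display after it (arXiv:1506.07977v2 p. 36)] -/
theorem sum_sum_perc_T_ge_eqOne_ge_toReal_le_slots (hd : 2 ≤ d) (hp : p < criticalProbI d) {m₁ m₃ M : ℕ}
    (hm : 1 + m₃ ≤ M) {x : Site d} {X : Set (Site d)} (hx : x ∈ X) {R₁ R₂ : ℝ}
    (hR₁ : IsRemKernelConst d [M] X R₁) (hR₂ : IsRemKernelConst d [M - (1 + m₃), 1 + m₃] X R₂)
    (S₁ S₂ : Finset (Site d)) :
    ∑ v ∈ S₁, ∑ y ∈ S₂, ((Letters.perc d p).T (ge m₁) (eq 1) (ge m₃) v y x).toReal ≤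
      (∑ L ∈ Finset.Ico (m₁ + (1 + m₃)) M,
          ((L + 1 - m₁ - (1 + m₃) : ℕ) : ℝ) * ((trailWordsTo d L x).card : ℝ) * (p : ℝ) ^ L) +
        ((M - m₁ - (1 + m₃) : ℕ) : ℝ) * ((p : ℝ) ^ M * (nobleSup2 d p * R₁)) +
          (p : ℝ) ^ M * (nobleSup2 d p ^ 2 * R₂) :=
  sum_le_repBubble_slots (D := fun v => ∑ y ∈ S₂, ((Letters.perc d p).T (ge m₁) (eq 1) (ge m₃) v y x).toReal)
    (fun S => sum_le_extraction_of_pointwise p m₁ (1 + m₃) M x S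
      fun v _ => sum_perc_T_ge_eqOne_ge_toReal_le_extraction p m₁ m₃ M x v S₂)
    hd hp hm hx hR₁ hR₂ S₁

/-- **EXL-XSLOT (interior exact leg), `∑'`/`ofReal` shape in the `bubbleSlotR` currency**: for `x ∈ X`,
`Σ'_v Σ'_y 𝓣_{m₁,1̲,m₃}(v,y,x) ≤ ofReal (bubbleSlotR p Γ̄₂ m₁ (1+m₃) M N R₁ R₂)` whenever `N` majorises the trail-word
counts to `x` and `R₁, R₂` are remainder-kernel constants on `X` (`d ≥ 2`, `p < p_c`, `1 + m₃ ≤ M`): every finite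
double partial sum is below the right-hand side; the `∑'∑'` is their supremum.
[cite: FitznerVanDerHofstad2016NoBLE, §5.3.2 (5.40) (PTRF 169 (2017) p. 1098)]
[cite: FitznerVanDerHofstad2017, §4.2 (4.17), (4.18) and the display after it (arXiv:1506.07977v2 p. 36)] -/
theorem tsum_tsum_perc_T_ge_eqOne_ge_le_ofReal (hd : 2 ≤ d) (hp : p < criticalProbI d) {m₁ m₃ M : ℕ}
    (hm : 1 + m₃ ≤ M) {x : Site d} {X : Set (Site d)} (hx : x ∈ X) {N : ℕ → ℕ}
    (hN : ∀ L, (trailWordsTo d L x).card ≤ N L) {R₁ R₂ : ℝ} (hR₁ : IsRemKernelConst d [M] X R₁)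
    (hR₂ : IsRemKernelConst d [M - (1 + m₃), 1 + m₃] X R₂) :
    ∑' v, ∑' y, (Letters.perc d p).T (ge m₁) (eq 1) (ge m₃) v y x ≤
      ENNReal.ofReal (bubbleSlotR p (nobleSup2 d p) m₁ (1 + m₃) M N R₁ R₂) := by
  classical
  rw [← ENNReal.tsum_prod, ENNReal.tsum_eq_iSup_sum]
  refine iSup_le fun Q => ?_
  set f : Site d → Site d → ℝ≥0∞ := fun v y => (Letters.perc d p).T (ge m₁) (eq 1) (ge m₃) v y x with hf
  have hT : ∀ v y, f v y = ENNReal.ofReal ((f v y).toReal) := fun v y =>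
    (ENNReal.ofReal_toReal ((perc_T_le_one p _ _ _ _ _ _).trans_lt ENNReal.one_lt_top).ne).symm
  calc ∑ q ∈ Q, f q.1 q.2
      ≤ ∑ q ∈ Q.image Prod.fst ×ˢ Q.image Prod.snd, f q.1 q.2 :=
        Finset.sum_le_sum_of_subset Finset.subset_product
    _ = ∑ v ∈ Q.image Prod.fst, ∑ y ∈ Q.image Prod.snd, f v y := Finset.sum_product _ _ _
    _ = ∑ v ∈ Q.image Prod.fst, ∑ y ∈ Q.image Prod.snd, ENNReal.ofReal ((f v y).toReal) :=
        Finset.sum_congr rfl fun v _ => Finset.sum_congr rfl fun y _ => hT v y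
    _ = ENNReal.ofReal (∑ v ∈ Q.image Prod.fst, ∑ y ∈ Q.image Prod.snd, (f v y).toReal) := by
        rw [ENNReal.ofReal_sum_of_nonneg fun v _ => Finset.sum_nonneg fun y _ => ENNReal.toReal_nonneg]
        exact Finset.sum_congr rfl fun v _ =>
          (ENNReal.ofReal_sum_of_nonneg fun y _ => ENNReal.toReal_nonneg).symm
    _ ≤ ENNReal.ofReal (bubbleSlotR p (nobleSup2 d p) m₁ (1 + m₃) M N R₁ R₂) :=
        ENNReal.ofReal_le_ofReal
          ((sum_sum_perc_T_ge_eqOne_ge_toReal_le_slots p hd hp hm hx hR₁ hR₂ _ _).trans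
            (bubbleSlotR_mono_count p.2.1 m₁ (1 + m₃) M hN R₁ R₂))

end Letter

/-! ## G. The cells: `P^{E}_1`, `(A)_{0,1}` (endpoint `0`) and `(A)_{1,1}` (endpoint a unit vector) -/

section Cells

variable (p : unitInterval)

/-- **`Σ'_x Σ'_y (1 − δ_{y,0}) 𝓣_{1,1̲,1}(x,y,0) ≤ ofReal (bubbleSlotR p Γ̄₂ 1 2 M N₀ R₁ R₂)`** — the letter sum of
`(A)_{0,1}` and of `P^{E}_1` by EXL-XSLOT at the endpoint `0` (`N₀` majorises the closed trail-word counts, `R₁` valid for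
`[M]`, `R₂` for `[M−2, 2]` on a set containing `0`; `2 ≤ M`).
[cite: FitznerVanDerHofstad2017, App. B Table B.2 row (0,1), Table "P^b" row b = 1 (arXiv:1506.07977v2 p. 73)]
[cite: FitznerVanDerHofstad2016NoBLE, §5.3.2 (5.40) (PTRF 169 (2017) p. 1098); notebook Percolation.nb cell 10 (Bubble₃)] -/
theorem perc_tsum_tsum_kdc_T_one_eqOne_one_le_xslot (hd : 2 ≤ d) (hp : p < criticalProbI d) {M : ℕ} (hM : 2 ≤ M)
    {X : Set (Site d)} (h0 : (0 : Site d) ∈ X) {N₀ : ℕ → ℕ}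
    (hN : ∀ L, (trailWordsTo d L (0 : Site d)).card ≤ N₀ L) {R₁ R₂ : ℝ} (hR₁ : IsRemKernelConst d [M] X R₁)
    (hR₂ : IsRemKernelConst d [M - 2, 2] X R₂) :
    ∑' x, ∑' y, kdc y 0 * (Letters.perc d p).T (.ge 1) (.eq 1) (.ge 1) x y 0 ≤
      ENNReal.ofReal (bubbleSlotR p (nobleSup2 d p) 1 2 M N₀ R₁ R₂) := by
  refine le_trans (ENNReal.tsum_le_tsum fun x => ENNReal.tsum_le_tsum fun y => ?_)
    (tsum_tsum_perc_T_ge_eqOne_ge_le_ofReal p hd hp (m₁ := 1) (m₃ := 1) hM h0 hN hR₁ hR₂)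
  calc kdc y 0 * (Letters.perc d p).T (.ge 1) (.eq 1) (.ge 1) x y 0
      ≤ 1 * (Letters.perc d p).T (.ge 1) (.eq 1) (.ge 1) x y 0 := by gcongr; exact kdc_le_one y 0
    _ = _ := one_mul _

/-- **`(A)_{0,1}` by EXL-XSLOT**: `(A)_{0,1} ≤ bubbleSlotR p Γ̄₂ 1 2 M N₀ R₁ R₂` (closed counts; replaces the tier-P peel
`perc_matA_zero_one_le_peel`).
[cite: FitznerVanDerHofstad2017, App. B Table B.2 row (0,1) (arXiv:1506.07977v2 p. 73); (5.1) p. 49]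
[cite: FitznerVanDerHofstad2016NoBLE, §5.3.2 (5.40) (PTRF 169 (2017) p. 1098)] -/
theorem perc_matA_zero_one_le_xslot (hd : 2 ≤ d) (hp : p < criticalProbI d) {M : ℕ} (hM : 2 ≤ M)
    {X : Set (Site d)} (h0 : (0 : Site d) ∈ X) {N₀ : ℕ → ℕ}
    (hN : ∀ L, (trailWordsTo d L (0 : Site d)).card ≤ N₀ L) {R₁ R₂ : ℝ} (hR₁ : IsRemKernelConst d [M] X R₁)
    (hR₂ : IsRemKernelConst d [M - 2, 2] X R₂) :
    matA (Letters.perc d p) 0 1 ≤ ENNReal.ofReal (bubbleSlotR p (nobleSup2 d p) 1 2 M N₀ R₁ R₂) := by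
  rw [matA_zero_one]
  exact perc_tsum_tsum_kdc_T_one_eqOne_one_le_xslot p hd hp hM h0 hN hR₁ hR₂

/-- **`P^{E}_1` by EXL-XSLOT**: `P^{E}_1 ≤ bubbleSlotR p Γ̄₂ 1 2 M N₀ R₁ R₂` (drop `x ≠ 0`; replaces the tier-P peel
`perc_vecPE_one_le_peel`).
[cite: FitznerVanDerHofstad2017, App. B Table "P^b" row b = 1 (arXiv:1506.07977v2 p. 73); §5.1 Table "P^{E,b}" (p. 47)]
[cite: FitznerVanDerHofstad2016NoBLE, §5.3.2 (5.40) (PTRF 169 (2017) p. 1098)] -/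
theorem perc_vecPE_one_le_xslot (hd : 2 ≤ d) (hp : p < criticalProbI d) {M : ℕ} (hM : 2 ≤ M)
    {X : Set (Site d)} (h0 : (0 : Site d) ∈ X) {N₀ : ℕ → ℕ}
    (hN : ∀ L, (trailWordsTo d L (0 : Site d)).card ≤ N₀ L) {R₁ R₂ : ℝ} (hR₁ : IsRemKernelConst d [M] X R₁)
    (hR₂ : IsRemKernelConst d [M - 2, 2] X R₂) :
    vecPE (Letters.perc d p) 1 ≤ ENNReal.ofReal (bubbleSlotR p (nobleSup2 d p) 1 2 M N₀ R₁ R₂) := by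
  refine le_trans ?_ (perc_tsum_tsum_kdc_T_one_eqOne_one_le_xslot p hd hp hM h0 hN hR₁ hR₂)
  rw [vecPE_one]
  refine ENNReal.tsum_le_tsum fun x => ENNReal.tsum_le_tsum fun y => ?_
  calc kdc x 0 * kdc y 0 * (Letters.perc d p).T (.ge 1) (.eq 1) (.ge 1) x y 0
      ≤ 1 * kdc y 0 * (Letters.perc d p).T (.ge 1) (.eq 1) (.ge 1) x y 0 := by
        gcongr
        exact kdc_le_one x 0
    _ = _ := by rw [one_mul]

/-- **`(A)_{1,1}` by EXL-XSLOT**: `(A)_{1,1} = Σ_{x,y} 𝓣_{1,1̲,0}(x,y,e_{ι₀}) ≤ bubbleSlotR p Γ̄₂ 1 1 M N R₁ R₂` at the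
unit class (`N` majorises the trail-word counts to `e_{ι₀}`, `R₁` valid for `[M]`, `R₂` for `[M−1, 1]` on a set
containing `e_{ι₀}`; `1 ≤ M`) — no peel, no `2d·p` prefactor: the exact bond is a slot of the trail.
[cite: FitznerVanDerHofstad2017, App. B Table B.2 row (1,1) (arXiv:1506.07977v2 p. 73); (5.1) p. 49]
[cite: FitznerVanDerHofstad2016NoBLE, §5.3.2 (5.40) (PTRF 169 (2017) p. 1098)] -/
theorem perc_matA_one_one_le_xslot (hd : 2 ≤ d) (hp : p < criticalProbI d) {M : ℕ} (hM : 1 ≤ M)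
    (ι₀ : Fin d × Bool) {X : Set (Site d)} (hι : (stepVec ι₀ : Site d) ∈ X) {N : ℕ → ℕ}
    (hN : ∀ L, (trailWordsTo d L (stepVec ι₀ : Site d)).card ≤ N L) {R₁ R₂ : ℝ}
    (hR₁ : IsRemKernelConst d [M] X R₁) (hR₂ : IsRemKernelConst d [M - 1, 1] X R₂) :
    matA (Letters.perc d p) 1 1 ≤ ENNReal.ofReal (bubbleSlotR p (nobleSup2 d p) 1 1 M N R₁ R₂) := by
  rw [perc_matA_one_one p ι₀]
  exact tsum_tsum_perc_T_ge_eqOne_ge_le_ofReal p hd hp (m₁ := 1) (m₃ := 0) hM hι hN hR₁ hR₂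

end Cells

end Literature.Probability.FitznerVanDerHofstad2017.NobleBlocks
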